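import Mathlib.Analysis.Calculus.ContDiff.Operations
import Mathlib.Analysis.SpecialFunctions.Sqrt
import Mathlib.Analysis.Matrix.PosDef
import Literature.Geometry.Riemannian.ChernTransgression
import Literature.NumberTheory.Transcendental.SemialgebraicLineDeriv
import HarnessLib

/-!
# Semialgebraicity of the Euler density and of Chern's transgression form (proof file)

Sibling proof file of `Literature/Geometry/Riemannian/ChernTransgression.lean`: discharge of its
named fact `Literature.Geometry.Riemannian.isSemialgebraicFunOn_eulerDensity_chernTransgression`
(Bochnak–Coste–Roy 1998, Prop. 2.2.6 and §2.9; Basu–Pollack–Roy 2006, Prop. 2.85 and Prop. 3.22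
with the remark on partial derivatives following it). If on an open `ℚ`-semialgebraic `W ⊆ ℝᵈ` the
entries of the coordinate metric `g` are `ℚ`-semialgebraic of class `C²` with `g` positive
definite, and the components of the vector field `V` are `ℚ`-semialgebraic of class `C¹` with
`V ≠ 0`, then the Euler density `E = eulerDensity g` and the components
`Πᵢ = chernTransgression g V i` of the pulled-back transgression form are `ℚ`-semialgebraic on `W`.

## Proof (as printed: "obtained from `g, ∂g, ∂²g, V, ∂V` by `+, ×, (·)⁻¹, √·`, and partial
derivatives of semialgebraic `C¹` functions on open semialgebraic sets are semialgebraic")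

Read off the definitions of `ChernTransgression.lean` bottom-up, alternating two closure
principles:

* *arithmetic* — semialgebraic functions on `W` form a ring closed under `⁻¹` and `√·`
  (Bochnak–Coste–Roy Prop. 2.2.6; the tree's `add_holds`, `mul_holds`, `sqrt_holds` and the
  pointwise kit of `SemialgebraicLineDeriv.lean`: finite sums and products, `fun_inv`,
  `matrix_det`, `matrix_inv_apply`, rational constants);
* *derivatives* — a partial derivative `coordPartial k f = (fderiv ℝ f · (Pi.single k 1))` of a
  `ℚ`-semialgebraic function differentiable on the open set `W` is `ℚ`-semialgebraic
  (`IsSemialgebraicFunOn.fderiv_apply_single`, Basu–Pollack–Roy Prop. 3.22), which requires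
  keeping track of differentiability: `∂g` and `g⁻¹ = (det g)⁻¹ adj g` are `C¹` (`det g > 0` by
  positive definiteness), hence so are the Christoffel symbols `Γ`; `|V|²_g > 0` on `W`, so the unit
  field `u = V/|V|_g` is `C¹`.

In this order: `g`, `∂g`, `g⁻¹`, `Γ` (semialgebraic and `C¹`), `∂Γ`, `R`, `det g`, `√det g`, `E`;
`|V|²_g`, `u` (semialgebraic and `C¹`), `∂u`, `g u`, `∇u`, the transgression sums `Tₖ(i)`, `Πᵢ`.

## References

* J. Bochnak, M. Coste, M.-F. Roy, *Real Algebraic Geometry*, Springer (1998), §2.2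
  (Prop. 2.2.6), §2.9. [`BochnakCosteRoy1998`]
* S. Basu, R. Pollack, M.-F. Roy, *Algorithms in Real Algebraic Geometry*, 2nd ed., Springer
  (2006), Prop. 2.85, §3.5 Prop. 3.22. [`BasuPollackRoy2006`]
-/

noncomputable section

open Set
open scoped Topology Matrix Nat

namespace Literature.Geometry.Riemannian

open Literature.NumberTheory.Transcendental Literature.ModelTheory.ExponentialFields

variable {d : ℕ} {W : Set (Fin d → ℝ)}

/-! ### Calculus: partial derivatives, determinants, inverse matrices -/

section Calculus

/-- On an open set, the coordinate partial derivatives `coordPartial k f = ∂ₖf` of a `C²` function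
are `C¹`. [folklore] -/
theorem contDiffOn_coordPartial {f : (Fin d → ℝ) → ℝ} (hW : IsOpen W) (hf : ContDiffOn ℝ 2 f W)
    (k : Fin d) : ContDiffOn ℝ 1 (fun x => coordPartial k f x) W := by
  unfold coordPartial
  exact (hf.fderiv_of_isOpen hW one_add_one_eq_two.le).clm_apply contDiffOn_const

/-- On an open set, a `C¹` function is differentiable at every point. [folklore] -/
theorem differentiableAt_of_contDiffOn_one {f : (Fin d → ℝ) → ℝ} (hW : IsOpen W)
    (hf : ContDiffOn ℝ 1 f W) {x : Fin d → ℝ} (hx : x ∈ W) : DifferentiableAt ℝ f x :=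
  (hf.differentiableOn one_ne_zero).differentiableAt (hW.mem_nhds hx)

/-- **Partial derivatives of semialgebraic `C¹` functions are semialgebraic**: on an open set `W`,
if `f` is `ℚ`-semialgebraic and `C¹` then each `coordPartial k f` is `ℚ`-semialgebraic on `W`
(`IsSemialgebraicFunOn.fderiv_apply_single`; Basu–Pollack–Roy 2006, Prop. 3.22 and the remark on
partial derivatives; Bochnak–Coste–Roy 1998, §2.9). [cite: BasuPollackRoy2006, Prop. 3.22] -/
theorem isSemialgebraicFunOn_coordPartial {f : (Fin d → ℝ) → ℝ} (hW : IsOpen W)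
    (hf : IsSemialgebraicFunOn ℚ W f) (hf1 : ContDiffOn ℝ 1 f W) (k : Fin d) :
    IsSemialgebraicFunOn ℚ W fun x => coordPartial k f x :=
  hf.fderiv_apply_single hW (fun _ hx => differentiableAt_of_contDiffOn_one hW hf1 hx) k

/-- The determinant of a square matrix of `Cⁿ` functions is `Cⁿ` (Leibniz expansion).
[folklore] -/
theorem contDiffOn_matrix_det {ι : Type*} [Fintype ι] [DecidableEq ι] {n : WithTop ℕ∞}
    {M : (Fin d → ℝ) → Matrix ι ι ℝ} (hM : ∀ i j, ContDiffOn ℝ n (fun x => M x i j) W) :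
    ContDiffOn ℝ n (fun x => (M x).det) W := by
  simp only [Matrix.det_apply']
  exact ContDiffOn.sum fun σ _ => contDiffOn_const.mul (contDiffOn_prod fun i _ => hM _ _)

/-- The entries of the inverse of a square matrix of `Cⁿ` functions with non-vanishing
determinant are `Cⁿ` (`A⁻¹ = (det A)⁻¹ adj A`). [folklore] -/
theorem contDiffOn_matrix_inv_apply {ι : Type*} [Fintype ι] [DecidableEq ι] {n : WithTop ℕ∞}
    {M : (Fin d → ℝ) → Matrix ι ι ℝ} (hM : ∀ i j, ContDiffOn ℝ n (fun x => M x i j) W)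
    (hdet : ∀ x ∈ W, (M x).det ≠ 0) (i j : ι) :
    ContDiffOn ℝ n (fun x => (M x)⁻¹ i j) W := by
  simp only [matrix_inv_apply_eq]
  refine ((contDiffOn_matrix_det hM).inv hdet).mul (contDiffOn_matrix_det fun a b => ?_)
  by_cases ha : a = j
  · subst ha
    simp only [Matrix.updateRow_self]
    exact contDiffOn_const
  · simp only [Matrix.updateRow_ne ha]
    exact hM a b

/-- The squared length `|v|²_g` of a non-zero vector for a positive definite `g` is positive.
[folklore] -/
theorem metricNormSq_pos {g : (Fin d → ℝ) → Matrix (Fin d) (Fin d) ℝ} {x v : Fin d → ℝ}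
    (hg : (g x).PosDef) (hv : v ≠ 0) : 0 < metricNormSq g x v := by
  unfold metricNormSq
  simpa using hg.dotProduct_mulVec_pos hv

end Calculus

/-! ### The metric: Christoffel symbols, curvature, Euler density -/

section Metric

variable {g : (Fin d → ℝ) → Matrix (Fin d) (Fin d) ℝ}

/-- The Christoffel symbols of a positive definite `C²` coordinate metric on an open set are `C¹`
(`Γ = ½ g⁻¹ ∂g` with `g⁻¹ = (det g)⁻¹ adj g`, `det g > 0`). [cite: Lee2018, (5.10)] -/
theorem contDiffOn_coordChristoffel (hWo : IsOpen W) (hpos : ∀ x ∈ W, (g x).PosDef)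
    (hg2 : ∀ i j, ContDiffOn ℝ 2 (fun x => g x i j) W) (i j k : Fin d) :
    ContDiffOn ℝ 1 (fun x => coordChristoffel g x i j k) W := by
  have hdg : ∀ a b c, ContDiffOn ℝ 1 (fun x => coordPartial c (fun y => g y a b) x) W :=
    fun a b c => contDiffOn_coordPartial hWo (hg2 a b) c
  have hg1 : ∀ a b, ContDiffOn ℝ 1 (fun x => g x a b) W := fun a b => (hg2 a b).of_le one_le_two
  have hdet : ∀ x ∈ W, (g x).det ≠ 0 := fun x hx => (hpos x hx).det_pos.ne'
  unfold coordChristoffel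
  exact contDiffOn_const.mul (ContDiffOn.sum fun l _ =>
    (contDiffOn_matrix_inv_apply hg1 hdet i l).mul (((hdg l k j).add (hdg j l k)).sub (hdg j k l)))

/-- **The Christoffel symbols of a semialgebraic metric are semialgebraic**: for `g` positive
definite with `ℚ`-semialgebraic `C²` entries on an open `ℚ`-semialgebraic `W`, each `Γⁱⱼₖ` is
`ℚ`-semialgebraic on `W` (inverse matrix by Cramer's rule, partial derivatives by
Basu–Pollack–Roy Prop. 3.22). [cite: BochnakCosteRoy1998, Prop. 2.2.6 and §2.9] -/
theorem isSemialgebraicFunOn_coordChristoffel (hWo : IsOpen W) (hWs : IsSemialgebraic ℚ W)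
    (hg : ∀ i j, IsSemialgebraicFunOn ℚ W fun x => g x i j)
    (hg2 : ∀ i j, ContDiffOn ℝ 2 (fun x => g x i j) W) (i j k : Fin d) :
    IsSemialgebraicFunOn ℚ W fun x => coordChristoffel g x i j k := by
  have hdg : ∀ a b c, IsSemialgebraicFunOn ℚ W fun x => coordPartial c (fun y => g y a b) x :=
    fun a b c => isSemialgebraicFunOn_coordPartial hWo (hg a b) ((hg2 a b).of_le one_le_two) c
  have h2 : IsSemialgebraicFunOn ℚ W fun _ => (2 : ℝ)⁻¹ :=
    (isSemialgebraicFunOn_const_ofNat hWs 2).fun_inv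
  unfold coordChristoffel
  exact h2.fun_mul (IsSemialgebraicFunOn.fun_finsetSum _ hWs fun l _ =>
    (IsSemialgebraicFunOn.matrix_inv_apply hWs hg i l).fun_mul
      (((hdg l k j).fun_add (hdg j l k)).fun_sub (hdg j k l)))

/-- **The Riemann tensor of a semialgebraic metric is semialgebraic**: under the same hypotheses,
each `Rᵢⱼₖₗ = gᵢₘ Rᵐⱼₖₗ`, `Rᵐⱼₖₗ = ∂ₖΓ - ∂ₗΓ + ΓΓ - ΓΓ`, is `ℚ`-semialgebraic on `W` (the `Γ` are
semialgebraic and `C¹`, so their partial derivatives are semialgebraic).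
[cite: BochnakCosteRoy1998, Prop. 2.2.6 and §2.9] -/
theorem isSemialgebraicFunOn_coordRiemann (hWo : IsOpen W) (hWs : IsSemialgebraic ℚ W)
    (hpos : ∀ x ∈ W, (g x).PosDef) (hg : ∀ i j, IsSemialgebraicFunOn ℚ W fun x => g x i j)
    (hg2 : ∀ i j, ContDiffOn ℝ 2 (fun x => g x i j) W) (i j k l : Fin d) :
    IsSemialgebraicFunOn ℚ W fun x => coordRiemann g x i j k l := by
  have hΓ := isSemialgebraicFunOn_coordChristoffel hWo hWs hg hg2
  have hΓ1 := contDiffOn_coordChristoffel hWo hpos hg2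
  have hdΓ : ∀ a b c e, IsSemialgebraicFunOn ℚ W fun x =>
      coordPartial e (fun y => coordChristoffel g y a b c) x :=
    fun a b c e => isSemialgebraicFunOn_coordPartial hWo (hΓ a b c) (hΓ1 a b c) e
  have hRup : ∀ a b c e, IsSemialgebraicFunOn ℚ W fun x => coordRiemannUp g x a b c e := by
    intro a b c e
    unfold coordRiemannUp
    exact ((hdΓ a e b c).fun_sub (hdΓ a c b e)).fun_add
      (IsSemialgebraicFunOn.fun_finsetSum _ hWs fun m _ =>
        ((hΓ a c m).fun_mul (hΓ m e b)).fun_sub ((hΓ a e m).fun_mul (hΓ m c b)))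
  unfold coordRiemann
  exact IsSemialgebraicFunOn.fun_finsetSum _ hWs fun m _ => (hg i m).fun_mul (hRup m j k l)

/-- **The Euler density of a semialgebraic metric is semialgebraic**: under the same hypotheses,
`E = (4ᵖ p! √det g)⁻¹ ∑ ± ∏ R` is `ℚ`-semialgebraic on `W` (curvature components, `√·`, `⁻¹`,
finite sums and products; Bochnak–Coste–Roy Prop. 2.2.6 and §2.9).
[cite: BochnakCosteRoy1998, Prop. 2.2.6 and §2.9] -/
theorem isSemialgebraicFunOn_eulerDensity (hWo : IsOpen W) (hWs : IsSemialgebraic ℚ W)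
    (hpos : ∀ x ∈ W, (g x).PosDef) (hg : ∀ i j, IsSemialgebraicFunOn ℚ W fun x => g x i j)
    (hg2 : ∀ i j, ContDiffOn ℝ 2 (fun x => g x i j) W) :
    IsSemialgebraicFunOn ℚ W (eulerDensity g) := by
  have hR := isSemialgebraicFunOn_coordRiemann hWo hWs hpos hg hg2
  have hc : IsSemialgebraicFunOn ℚ W fun _ => (4 : ℝ) ^ (d / 2) * ((d / 2)! : ℝ) :=
    (isSemialgebraicFunOn_const_natCast hWs (4 ^ (d / 2) * (d / 2)!)).congr fun _ _ => by
      push_cast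
      ring
  have hdet : IsSemialgebraicFunOn ℚ W fun x => Real.sqrt (g x).det :=
    (IsSemialgebraicFunOn.matrix_det hWs hg).fun_sqrt
  show IsSemialgebraicFunOn ℚ W fun x => eulerDensity g x
  simp only [eulerDensity, eulerDensitySum]
  exact (hc.fun_mul hdet).fun_inv.fun_mul
    (IsSemialgebraicFunOn.fun_finsetSum _ hWs fun σ _ =>
      IsSemialgebraicFunOn.fun_finsetSum _ hWs fun τ _ =>
        ((isSemialgebraicFunOn_const_intCast hWs _).fun_mul
          (isSemialgebraicFunOn_const_intCast hWs _)).fun_mul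
          (IsSemialgebraicFunOn.fun_finsetProd _ hWs fun m _ => hR _ _ _ _))

end Metric

/-! ### The vector field: unit field, its covariant derivative, the transgression form -/

section Field

variable {g : (Fin d → ℝ) → Matrix (Fin d) (Fin d) ℝ} {V : (Fin d → ℝ) → (Fin d → ℝ)}

/-- The squared `g`-length `x ↦ |V x|²_g` of a vector field is `ℚ`-semialgebraic when `g` and `V`
have `ℚ`-semialgebraic entries. [cite: BochnakCosteRoy1998, Prop. 2.2.6] -/
theorem isSemialgebraicFunOn_metricNormSq (hWs : IsSemialgebraic ℚ W)
    (hg : ∀ i j, IsSemialgebraicFunOn ℚ W fun x => g x i j)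
    (hV : ∀ j, IsSemialgebraicFunOn ℚ W fun x => V x j) :
    IsSemialgebraicFunOn ℚ W fun x => metricNormSq g x (V x) := by
  simp only [metricNormSq, Matrix.mulVec, dotProduct]
  exact IsSemialgebraicFunOn.fun_finsetSum _ hWs fun i _ => (hV i).fun_mul
    (IsSemialgebraicFunOn.fun_finsetSum _ hWs fun j _ => (hg i j).fun_mul (hV j))

/-- The unit field `u = V/|V|_g` of a non-vanishing `C¹` field for a positive definite `C¹` metric
is `C¹` (`|V|²_g > 0`, so `√·` and `⁻¹` are smooth there). [folklore] -/
theorem contDiffOn_unitField (hpos : ∀ x ∈ W, (g x).PosDef)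
    (hg1 : ∀ i j, ContDiffOn ℝ 1 (fun x => g x i j) W)
    (hV1 : ∀ j, ContDiffOn ℝ 1 (fun x => V x j) W) (hV0 : ∀ x ∈ W, V x ≠ 0) (j : Fin d) :
    ContDiffOn ℝ 1 (fun x => unitField g V x j) W := by
  have hN : ContDiffOn ℝ 1 (fun x => metricNormSq g x (V x)) W := by
    simp only [metricNormSq, Matrix.mulVec, dotProduct]
    exact ContDiffOn.sum fun i _ => (hV1 i).mul (ContDiffOn.sum fun l _ => (hg1 i l).mul (hV1 l))
  have hN0 : ∀ x ∈ W, metricNormSq g x (V x) ≠ 0 :=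
    fun x hx => (metricNormSq_pos (hpos x hx) (hV0 x hx)).ne'
  have hsq0 : ∀ x ∈ W, Real.sqrt (metricNormSq g x (V x)) ≠ 0 :=
    fun x hx => (Real.sqrt_pos.mpr (metricNormSq_pos (hpos x hx) (hV0 x hx))).ne'
  simp only [unitField, Pi.smul_apply, smul_eq_mul]
  exact ((hN.sqrt hN0).inv hsq0).mul (hV1 j)

/-- **The unit field of a semialgebraic field is semialgebraic**: the components of
`u = V/|V|_g` are `ℚ`-semialgebraic on `W` when `g` and `V` have `ℚ`-semialgebraic entries
(`√·`, `⁻¹`, products; Bochnak–Coste–Roy Prop. 2.2.6). [cite: BochnakCosteRoy1998, Prop. 2.2.6] -/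
theorem isSemialgebraicFunOn_unitField (hWs : IsSemialgebraic ℚ W)
    (hg : ∀ i j, IsSemialgebraicFunOn ℚ W fun x => g x i j)
    (hV : ∀ j, IsSemialgebraicFunOn ℚ W fun x => V x j) (j : Fin d) :
    IsSemialgebraicFunOn ℚ W fun x => unitField g V x j := by
  simp only [unitField, Pi.smul_apply, smul_eq_mul]
  exact (isSemialgebraicFunOn_metricNormSq hWs hg hV).fun_sqrt.fun_inv.fun_mul (hV j)

/-- **The covariant derivative of the unit field is semialgebraic**: under the hypotheses of the
fact (open `ℚ`-semialgebraic `W`, `g` positive definite with `ℚ`-semialgebraic `C²` entries, `V`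
non-vanishing with `ℚ`-semialgebraic `C¹` components), each `(∇ₖu)ᵢ = gᵢⱼ(∂ₖuʲ + Γʲₖₗuˡ)` is
`ℚ`-semialgebraic on `W` (`u` is semialgebraic and `C¹`, so `∂u` is semialgebraic by
Basu–Pollack–Roy Prop. 3.22). [cite: BochnakCosteRoy1998, Prop. 2.2.6 and §2.9] -/
theorem isSemialgebraicFunOn_covDerivUnitField (hWo : IsOpen W) (hWs : IsSemialgebraic ℚ W)
    (hpos : ∀ x ∈ W, (g x).PosDef) (hg : ∀ i j, IsSemialgebraicFunOn ℚ W fun x => g x i j)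
    (hg2 : ∀ i j, ContDiffOn ℝ 2 (fun x => g x i j) W)
    (hV : ∀ j, IsSemialgebraicFunOn ℚ W fun x => V x j)
    (hV1 : ∀ j, ContDiffOn ℝ 1 (fun x => V x j) W) (hV0 : ∀ x ∈ W, V x ≠ 0) (i k : Fin d) :
    IsSemialgebraicFunOn ℚ W fun x => covDerivUnitField g V x i k := by
  have hu := isSemialgebraicFunOn_unitField hWs hg hV
  have hu1 := contDiffOn_unitField hpos (fun a b => (hg2 a b).of_le one_le_two) hV1 hV0
  have hdu : ∀ a b, IsSemialgebraicFunOn ℚ W fun x =>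
      coordPartial b (fun y => unitField g V y a) x :=
    fun a b => isSemialgebraicFunOn_coordPartial hWo (hu a) (hu1 a) b
  have hΓ := isSemialgebraicFunOn_coordChristoffel hWo hWs hg hg2
  unfold covDerivUnitField
  exact IsSemialgebraicFunOn.fun_finsetSum _ hWs fun j _ => (hg i j).fun_mul ((hdu j k).fun_add
    (IsSemialgebraicFunOn.fun_finsetSum _ hWs fun l _ => (hΓ j k l).fun_mul (hu l)))

/-- **The transgression sums are semialgebraic**: under the hypotheses of the fact, each
`Tₖ(i) = chernTransgressionSum g V · k i` (an `ε`-`ε` contraction of `u`, curvature components and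
`∇u`) is `ℚ`-semialgebraic on `W`. [cite: BochnakCosteRoy1998, Prop. 2.2.6 and §2.9] -/
theorem isSemialgebraicFunOn_chernTransgressionSum (hWo : IsOpen W) (hWs : IsSemialgebraic ℚ W)
    (hpos : ∀ x ∈ W, (g x).PosDef) (hg : ∀ i j, IsSemialgebraicFunOn ℚ W fun x => g x i j)
    (hg2 : ∀ i j, ContDiffOn ℝ 2 (fun x => g x i j) W)
    (hV : ∀ j, IsSemialgebraicFunOn ℚ W fun x => V x j)
    (hV1 : ∀ j, ContDiffOn ℝ 1 (fun x => V x j) W) (hV0 : ∀ x ∈ W, V x ≠ 0) (k : Fin (d / 2))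
    (i : Fin d) : IsSemialgebraicFunOn ℚ W fun x => chernTransgressionSum g V x k i := by
  have hR := isSemialgebraicFunOn_coordRiemann hWo hWs hpos hg hg2
  have hu := isSemialgebraicFunOn_unitField hWs hg hV
  have hcov := isSemialgebraicFunOn_covDerivUnitField hWo hWs hpos hg hg2 hV hV1 hV0
  have hgu : ∀ a, IsSemialgebraicFunOn ℚ W fun x => (g x *ᵥ unitField g V x) a := by
    intro a
    simp only [Matrix.mulVec, dotProduct]
    exact IsSemialgebraicFunOn.fun_finsetSum _ hWs fun j _ => (hg a j).fun_mul (hu j)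
  unfold chernTransgressionSum
  refine IsSemialgebraicFunOn.fun_finsetSum _ hWs fun σ _ =>
    IsSemialgebraicFunOn.fun_finsetSum _ hWs fun τ _ => ?_
  by_cases h : τ (tgZero k) = i
  · simp only [if_pos h]
    exact ((((isSemialgebraicFunOn_const_intCast hWs _).fun_mul
      (isSemialgebraicFunOn_const_intCast hWs _)).fun_mul (hgu _)).fun_mul
      (IsSemialgebraicFunOn.fun_finsetProd _ hWs fun m _ => hR _ _ _ _)).fun_mul
      (IsSemialgebraicFunOn.fun_finsetProd _ hWs fun s _ => hcov _ _)
  · simp only [if_neg h]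
    exact (isSemialgebraicFunOn_const_natCast hWs 0).congr fun _ _ => Nat.cast_zero

/-- **The transgression components of semialgebraic data are semialgebraic**: under the
hypotheses of the fact, each `Πᵢ = chernTransgression g V i = -(√det g)⁻¹ ∑ₖ cₖ Tₖ(i)` (rational
coefficients `cₖ`) is `ℚ`-semialgebraic on `W`. [cite: BochnakCosteRoy1998, Prop. 2.2.6 and §2.9] -/
theorem isSemialgebraicFunOn_chernTransgression (hWo : IsOpen W) (hWs : IsSemialgebraic ℚ W)
    (hpos : ∀ x ∈ W, (g x).PosDef) (hg : ∀ i j, IsSemialgebraicFunOn ℚ W fun x => g x i j)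
    (hg2 : ∀ i j, ContDiffOn ℝ 2 (fun x => g x i j) W)
    (hV : ∀ j, IsSemialgebraicFunOn ℚ W fun x => V x j)
    (hV1 : ∀ j, ContDiffOn ℝ 1 (fun x => V x j) W) (hV0 : ∀ x ∈ W, V x ≠ 0) (i : Fin d) :
    IsSemialgebraicFunOn ℚ W (chernTransgression g V i) := by
  have hT := isSemialgebraicFunOn_chernTransgressionSum hWo hWs hpos hg hg2 hV hV1 hV0
  have hdet : IsSemialgebraicFunOn ℚ W fun x => Real.sqrt (g x).det :=
    (IsSemialgebraicFunOn.matrix_det hWs hg).fun_sqrt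
  have hc : ∀ k : ℕ, IsSemialgebraicFunOn ℚ W fun _ => chernTransgressionCoeff d k := fun k =>
    (isSemialgebraicFunOn_const_natCast hWs ((d - 2 * k - 1)‼ * 4 ^ k * k !)).fun_inv.congr
      fun _ _ => by
        simp only [chernTransgressionCoeff]
        push_cast
        ring
  show IsSemialgebraicFunOn ℚ W fun x => chernTransgression g V i x
  simp only [chernTransgression]
  exact (hdet.fun_inv.fun_mul (IsSemialgebraicFunOn.fun_finsetSum _ hWs
    fun (k : Fin (d / 2)) _ => (hc k).fun_mul (hT k i))).fun_neg

end Field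

/-! ### The fact -/

/-- **Semialgebraicity of the Euler density and of the transgression components** — discharge of
the named fact `isSemialgebraicFunOn_eulerDensity_chernTransgression`: if on an open
`ℚ`-semialgebraic `W ⊆ ℝᵈ` the entries of `g` are `ℚ`-semialgebraic of class `C²` with `g` positive
definite, and the components of `V` are `ℚ`-semialgebraic of class `C¹` with `V ≠ 0`, then
`E = eulerDensity g` and every `Πᵢ = chernTransgression g V i` are `ℚ`-semialgebraic functions on
`W`: they are obtained from `g, ∂g, ∂²g, V, ∂V` by `+, ×, (·)⁻¹` and `√·` (Bochnak–Coste–Roy 1998,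
Prop. 2.2.6; the tree's `add_holds`/`mul_holds`/`sqrt_holds`), and partial derivatives of
semialgebraic `C¹` functions on open semialgebraic sets are semialgebraic (Bochnak–Coste–Roy 1998,
§2.9; Basu–Pollack–Roy 2006, Prop. 3.22, the tree's `IsSemialgebraicFunOn.fderiv_apply_single`).
[cite: BochnakCosteRoy1998, §2.2 (Prop. 2.2.6) and §2.9] -/
theorem isSemialgebraicFunOn_eulerDensity_chernTransgression_holds :
    isSemialgebraicFunOn_eulerDensity_chernTransgression := by
  intro d W g V hWo hWs hpos hg hg2 hV hV1 hV0
  have hV1' : ∀ j, ContDiffOn ℝ 1 (fun x => V x j) W := fun j => contDiffOn_pi.mp hV1 j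
  exact ⟨isSemialgebraicFunOn_eulerDensity hWo hWs hpos hg hg2, fun i =>
    isSemialgebraicFunOn_chernTransgression hWo hWs hpos hg hg2 hV hV1' hV0 i⟩

end Literature.Geometry.Riemannian
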